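import Summits.QuantumFields.YangMills.Theorems.UnitScaleTiltProp7FrameCorrectedMinusMeanT3Rows
import HarnessLib

/-!
# Route `UnitScaleTilt`, crux K1 child «MinimiserStabilityRegPr» (stmt-QuantumFields-19200), skeleton v10, stub `stub_existenceMinimalOrbit` (EX), route (α) —
# **(ROW-V) THE RESPONSE OF THE ACCUMULATED FRAMES IS A ℂ-LINEAR MAP OF THE GAUGE PARAMETER** — the letter `V` of ✓`Prop7FrameLevelOnto.exists_frameCorrected_eq` ∕
# ✓`Prop7FrameCorrectedMinusMean.frameResponse_norm_sub_avgSeq_le` as ONE linear operator `N ↦ V N` (★w5-20520 g7's ROW-V for the (P2)-KNIT-Y1, 20:44:47Z∕20:46:25Z: «make `V` ℂ-linear»).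

Cell `ym3-torus`, width seat `ym3-torus-px6` (gen 2).  THEOREMS ONLY (0 `def`, 0 `sorry`).  `--supports stmt-QuantumFields-19200 --as helper`, count-neutral.  YM₃ on T³ is a ladder
rung (R3), not the Clay problem; nothing here claims the stub, the crux, d = 4 or the mass gap.

THE POINT.  FR₁ §4 (✓`hasDerivAt_frameAccU_succ_at`) gives the derivative of `frameAccU (k+1) U₀ (U′^{g_t})` from the level-`k` derivative `V_k` by a formula that is ℂ-LINEAR in the pair
`(N, V_k N)`: evaluations of `N`, left∕right multiplications by the tower's units `ν_k, w_k, D̄_k(Γ), τ_k`, and the continuous linear map `D eml(τ_k(y))`.  So along the gauge family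
`g_t = exp(tN)` the response is built level by level as a `LinearMap` (`IsLinearMap.mk'`), with NO estimate and NO smallness beyond FR₁'s `‖τ_j − 1‖ < 1∕3`:
**`∃ V : (Site P 0 → 𝔸) →ₗ[ℂ] (Site P k → 𝔸), ∀ N x, d∕dt|₀ frameAccU k U₀ (U′^{exp(tN)}) x = V N x`** (§1, generic), and at the T³ member from `RegPr` + the chart window (§2, the tower
row of ✓`towerData_of_regPr`).  Every row of ✓`…FrameCorrectedMinusMeanL2` applies to `V N` through its ∀-`V` form; the knit's `Kop` is `N ↦ toL2S F n c₁ ((N∘x̂ − V N·ν⁻¹) ∘ siteShift)`,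
linear by construction.

WHAT IS PROVED (sorry-free, no definition): §1 `expUnit_family_zero`, `hasDerivAt_expUnit_family`, ★★★`exists_linear_frameResponse`; §2 ★★★`exists_linear_frameResponse_of_regPr`.
HONEST SCOPE: linear-algebra packaging of FR₁'s displayed successor; nothing of print is asserted.

References: T. Bałaban, CMP 98 (1985) 17–51 [Balaban1985Averaging] ((8)–(9) p.18, (82) p.30, (97) p.32); CMP 99 (1985) 389–434 [Balaban1985BackgroundPropagators] ((3.19) p.393,
(3.114)–(3.115) p.418); CMP 102 (1985) 277–309 [Balaban1985Variational] ((2) p.278, (44) p.285).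
-/

set_option autoImplicit false

noncomputable section

open scoped BigOperators Topology
open Filter NormedSpace Metric

namespace Summit.QuantumFields.YangMills.Theorems.Prop7FrameCorrectedMinusMean

open Literature.MathematicalPhysics.QuantumFieldTheory.Balaban1983to89
open T4Continuum BlockAveraging ExpMeanLog MatrixLog
open B10Eq27TorusAxialLog (holT gaugeActT gaugeActT_apply transl)
open B7Prop1Explicit (expUnit val_expUnit disp)
open Summit.QuantumFields.YangMills.Theorems.Prop7SymAvgTwSym (tstairU vframeCovU dbarCovIterU frameAccU frameAccU_zero)
open Summit.QuantumFields.YangMills.Theorems.Prop7SymFrameGaugeResponseAt (hasDerivAt_frameAccU_succ_at)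
open Summit.QuantumFields.YangMills.Theorems.Prop8Chart (emlIterU)
open B15DeterminingSets (embIter)

/-! ## §1 The linear response, generic tower -/

section Generic

variable {P : Params} {𝔸 : Type*} [NormedRing 𝔸] [NormedAlgebra ℂ 𝔸] [CompleteSpace 𝔸]

/-- the gauge family `z ↦ exp(t·N z)` passes through `1` at `t = 0`. [cite: Balaban1985Averaging, (8)-(9) p.18] -/
theorem expUnit_family_zero (N : Site P 0 → 𝔸) : (fun z : Site P 0 => expUnit ((0 : ℝ) • N z)) = fun _ => (1 : 𝔸ˣ) := by
  funext z; apply Units.ext; rw [val_expUnit, zero_smul, exp_zero, Units.val_one]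

/-- the gauge family `z ↦ exp(t·N z)` has site derivative `N z` at `t = 0`. [cite: Balaban1985Averaging, (8)-(9) p.18] -/
theorem hasDerivAt_expUnit_family (N : Site P 0 → 𝔸) (z : Site P 0) :
    HasDerivAt (fun t : ℝ => ((expUnit (t • N z) : 𝔸ˣ) : 𝔸)) (N z) 0 := by
  have h1 := hasDerivAt_exp_smul_const' (𝕂 := ℝ) (N z) (0 : ℝ)
  simp only [zero_smul, exp_zero, mul_one] at h1
  have hfun : (fun t : ℝ => ((expUnit (t • N z) : 𝔸ˣ) : 𝔸)) = fun t => exp (t • N z) := by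
    funext t; rw [val_expUnit]
  rw [hfun]; exact h1

/-- ★★★ **THE FRAME RESPONSE IS ℂ-LINEAR IN THE GAUGE PARAMETER** (generic tower).  For level-`0` unit fields `U₀, U′` whose comparison tower has its stair transporters in the `eml`
ball at every level `j < k₀` (`‖τ_j(y) − 1‖ < 1∕3`), and every `k ≤ k₀`, there is a ℂ-linear map `V : (Site P 0 → 𝔸) →ₗ[ℂ] (Site P k → 𝔸)` such that for EVERY gauge parameter `N`
and every level-`k` site `x`: `d∕dt|₀ frameAccU k U₀ (U′^{exp(tN)}) x = V N x`.  Induction on `k` with FR₁ §4's successor, which is linear in `(N, V_k N)`. [cite: Balaban1985Averaging, (97) p.32, (82) p.30; Balaban1985BackgroundPropagators, (3.19) p.393] -/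
theorem exists_linear_frameResponse (U₀ U' : GaugeField P 0 𝔸ˣ) (k₀ : ℕ)
    (hτ : ∀ (j : ℕ) (y : Site P (j + 1)), j < k₀ → ‖(fun i : Idx P => ((tstairU (emlIterU j U₀) (dbarCovIterU j U₀ U') y i : 𝔸ˣ) : 𝔸)) - 1‖ < 1 / 3) :
    ∀ (k : ℕ), k ≤ k₀ → ∃ V : (Site P 0 → 𝔸) →ₗ[ℂ] (Site P k → 𝔸),
      ∀ (N : Site P 0 → 𝔸) (x : Site P k), HasDerivAt (fun t : ℝ => ((frameAccU k U₀ (gaugeActT (fun z : Site P 0 => expUnit (t • N z)) U') x : 𝔸ˣ) : 𝔸)) (V N x) 0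
  | 0, _ => by
    refine ⟨0, fun N x => ?_⟩
    have h1 : (fun t : ℝ => ((frameAccU 0 U₀ (gaugeActT (fun z : Site P 0 => expUnit (t • N z)) U') x : 𝔸ˣ) : 𝔸)) = fun _ => 1 := by
      funext t; rw [frameAccU_zero, Units.val_one]
    rw [h1, LinearMap.zero_apply, Pi.zero_apply]; exact hasDerivAt_const 0 1
  | k + 1, hk => by
    have hjk : k < k₀ := by omega
    obtain ⟨V, hV⟩ := exists_linear_frameResponse U₀ U' k₀ hτ k (by omega)
    -- FR₁'s successor as a function of `N`
    let F : (Site P 0 → 𝔸) → (Site P (k + 1) → 𝔸) := fun N y =>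
      V N (emb y) * ((vframeCovU (emlIterU k U₀) (dbarCovIterU k U₀ U') y : 𝔸ˣ) : 𝔸) +
        ((frameAccU k U₀ U' (emb y) : 𝔸ˣ) : 𝔸) *
          fderiv ℂ (eml : (Idx P → 𝔸) → 𝔸) (fun i : Idx P => ((tstairU (emlIterU k U₀) (dbarCovIterU k U₀ U') y i : 𝔸ˣ) : 𝔸))
            (fun i : Idx P =>
              ((((frameAccU k U₀ U' (emb y))⁻¹ : 𝔸ˣ) : 𝔸) * (N (embIter k (emb y)) - V N (emb y) * (((frameAccU k U₀ U' (emb y))⁻¹ : 𝔸ˣ) : 𝔸)) *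
                    ((frameAccU k U₀ U' (emb y) : 𝔸ˣ) : 𝔸) -
                  ((holT (dbarCovIterU k U₀ U') (emb y) (stairWord i.2.1 (off i.1)) : 𝔸ˣ) : 𝔸) *
                      ((((frameAccU k U₀ U' (transl (emb y) (disp (stairWord i.2.1 (off i.1)))))⁻¹ : 𝔸ˣ) : 𝔸) *
                          (N (embIter k (transl (emb y) (disp (stairWord i.2.1 (off i.1))))) -
                            V N (transl (emb y) (disp (stairWord i.2.1 (off i.1)))) *
                              (((frameAccU k U₀ U' (transl (emb y) (disp (stairWord i.2.1 (off i.1)))))⁻¹ : 𝔸ˣ) : 𝔸)) *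
                        ((frameAccU k U₀ U' (transl (emb y) (disp (stairWord i.2.1 (off i.1)))) : 𝔸ˣ) : 𝔸)) *
                    (((holT (dbarCovIterU k U₀ U') (emb y) (stairWord i.2.1 (off i.1)))⁻¹ : 𝔸ˣ) : 𝔸)) *
                ((tstairU (emlIterU k U₀) (dbarCovIterU k U₀ U') y i : 𝔸ˣ) : 𝔸))
    have hlin : IsLinearMap ℂ F := by
      constructor
      · intro N M
        funext y
        simp only [F, map_add, Pi.add_apply]
        have hin : (fun i : Idx P =>
              ((((frameAccU k U₀ U' (emb y))⁻¹ : 𝔸ˣ) : 𝔸) * (N (embIter k (emb y)) + M (embIter k (emb y)) - (V N (emb y) + V M (emb y)) * (((frameAccU k U₀ U' (emb y))⁻¹ : 𝔸ˣ) : 𝔸)) *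
                    ((frameAccU k U₀ U' (emb y) : 𝔸ˣ) : 𝔸) -
                  ((holT (dbarCovIterU k U₀ U') (emb y) (stairWord i.2.1 (off i.1)) : 𝔸ˣ) : 𝔸) *
                      ((((frameAccU k U₀ U' (transl (emb y) (disp (stairWord i.2.1 (off i.1)))))⁻¹ : 𝔸ˣ) : 𝔸) *
                          (N (embIter k (transl (emb y) (disp (stairWord i.2.1 (off i.1))))) + M (embIter k (transl (emb y) (disp (stairWord i.2.1 (off i.1))))) -
                            (V N (transl (emb y) (disp (stairWord i.2.1 (off i.1)))) + V M (transl (emb y) (disp (stairWord i.2.1 (off i.1))))) *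
                              (((frameAccU k U₀ U' (transl (emb y) (disp (stairWord i.2.1 (off i.1)))))⁻¹ : 𝔸ˣ) : 𝔸)) *
                        ((frameAccU k U₀ U' (transl (emb y) (disp (stairWord i.2.1 (off i.1)))) : 𝔸ˣ) : 𝔸)) *
                    (((holT (dbarCovIterU k U₀ U') (emb y) (stairWord i.2.1 (off i.1)))⁻¹ : 𝔸ˣ) : 𝔸)) *
                ((tstairU (emlIterU k U₀) (dbarCovIterU k U₀ U') y i : 𝔸ˣ) : 𝔸))
            = (fun i : Idx P =>
              ((((frameAccU k U₀ U' (emb y))⁻¹ : 𝔸ˣ) : 𝔸) * (N (embIter k (emb y)) - V N (emb y) * (((frameAccU k U₀ U' (emb y))⁻¹ : 𝔸ˣ) : 𝔸)) *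
                    ((frameAccU k U₀ U' (emb y) : 𝔸ˣ) : 𝔸) -
                  ((holT (dbarCovIterU k U₀ U') (emb y) (stairWord i.2.1 (off i.1)) : 𝔸ˣ) : 𝔸) *
                      ((((frameAccU k U₀ U' (transl (emb y) (disp (stairWord i.2.1 (off i.1)))))⁻¹ : 𝔸ˣ) : 𝔸) *
                          (N (embIter k (transl (emb y) (disp (stairWord i.2.1 (off i.1))))) -
                            V N (transl (emb y) (disp (stairWord i.2.1 (off i.1)))) *
                              (((frameAccU k U₀ U' (transl (emb y) (disp (stairWord i.2.1 (off i.1)))))⁻¹ : 𝔸ˣ) : 𝔸)) *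
                        ((frameAccU k U₀ U' (transl (emb y) (disp (stairWord i.2.1 (off i.1)))) : 𝔸ˣ) : 𝔸)) *
                    (((holT (dbarCovIterU k U₀ U') (emb y) (stairWord i.2.1 (off i.1)))⁻¹ : 𝔸ˣ) : 𝔸)) *
                ((tstairU (emlIterU k U₀) (dbarCovIterU k U₀ U') y i : 𝔸ˣ) : 𝔸))
              + (fun i : Idx P =>
              ((((frameAccU k U₀ U' (emb y))⁻¹ : 𝔸ˣ) : 𝔸) * (M (embIter k (emb y)) - V M (emb y) * (((frameAccU k U₀ U' (emb y))⁻¹ : 𝔸ˣ) : 𝔸)) *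
                    ((frameAccU k U₀ U' (emb y) : 𝔸ˣ) : 𝔸) -
                  ((holT (dbarCovIterU k U₀ U') (emb y) (stairWord i.2.1 (off i.1)) : 𝔸ˣ) : 𝔸) *
                      ((((frameAccU k U₀ U' (transl (emb y) (disp (stairWord i.2.1 (off i.1)))))⁻¹ : 𝔸ˣ) : 𝔸) *
                          (M (embIter k (transl (emb y) (disp (stairWord i.2.1 (off i.1))))) -
                            V M (transl (emb y) (disp (stairWord i.2.1 (off i.1)))) *
                              (((frameAccU k U₀ U' (transl (emb y) (disp (stairWord i.2.1 (off i.1)))))⁻¹ : 𝔸ˣ) : 𝔸)) *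
                        ((frameAccU k U₀ U' (transl (emb y) (disp (stairWord i.2.1 (off i.1)))) : 𝔸ˣ) : 𝔸)) *
                    (((holT (dbarCovIterU k U₀ U') (emb y) (stairWord i.2.1 (off i.1)))⁻¹ : 𝔸ˣ) : 𝔸)) *
                ((tstairU (emlIterU k U₀) (dbarCovIterU k U₀ U') y i : 𝔸ˣ) : 𝔸)) := by
          funext i; simp only [Pi.add_apply]; noncomm_ring
        rw [hin, map_add]
        noncomm_ring
      · intro c N
        funext y
        simp only [F, map_smul, Pi.smul_apply]
        have hin : (fun i : Idx P =>
              ((((frameAccU k U₀ U' (emb y))⁻¹ : 𝔸ˣ) : 𝔸) * (c • N (embIter k (emb y)) - c • V N (emb y) * (((frameAccU k U₀ U' (emb y))⁻¹ : 𝔸ˣ) : 𝔸)) *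
                    ((frameAccU k U₀ U' (emb y) : 𝔸ˣ) : 𝔸) -
                  ((holT (dbarCovIterU k U₀ U') (emb y) (stairWord i.2.1 (off i.1)) : 𝔸ˣ) : 𝔸) *
                      ((((frameAccU k U₀ U' (transl (emb y) (disp (stairWord i.2.1 (off i.1)))))⁻¹ : 𝔸ˣ) : 𝔸) *
                          (c • N (embIter k (transl (emb y) (disp (stairWord i.2.1 (off i.1))))) -
                            c • V N (transl (emb y) (disp (stairWord i.2.1 (off i.1)))) *
                              (((frameAccU k U₀ U' (transl (emb y) (disp (stairWord i.2.1 (off i.1)))))⁻¹ : 𝔸ˣ) : 𝔸)) *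
                        ((frameAccU k U₀ U' (transl (emb y) (disp (stairWord i.2.1 (off i.1)))) : 𝔸ˣ) : 𝔸)) *
                    (((holT (dbarCovIterU k U₀ U') (emb y) (stairWord i.2.1 (off i.1)))⁻¹ : 𝔸ˣ) : 𝔸)) *
                ((tstairU (emlIterU k U₀) (dbarCovIterU k U₀ U') y i : 𝔸ˣ) : 𝔸))
            = c • (fun i : Idx P =>
              ((((frameAccU k U₀ U' (emb y))⁻¹ : 𝔸ˣ) : 𝔸) * (N (embIter k (emb y)) - V N (emb y) * (((frameAccU k U₀ U' (emb y))⁻¹ : 𝔸ˣ) : 𝔸)) *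
                    ((frameAccU k U₀ U' (emb y) : 𝔸ˣ) : 𝔸) -
                  ((holT (dbarCovIterU k U₀ U') (emb y) (stairWord i.2.1 (off i.1)) : 𝔸ˣ) : 𝔸) *
                      ((((frameAccU k U₀ U' (transl (emb y) (disp (stairWord i.2.1 (off i.1)))))⁻¹ : 𝔸ˣ) : 𝔸) *
                          (N (embIter k (transl (emb y) (disp (stairWord i.2.1 (off i.1))))) -
                            V N (transl (emb y) (disp (stairWord i.2.1 (off i.1)))) *
                              (((frameAccU k U₀ U' (transl (emb y) (disp (stairWord i.2.1 (off i.1)))))⁻¹ : 𝔸ˣ) : 𝔸)) *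
                        ((frameAccU k U₀ U' (transl (emb y) (disp (stairWord i.2.1 (off i.1)))) : 𝔸ˣ) : 𝔸)) *
                    (((holT (dbarCovIterU k U₀ U') (emb y) (stairWord i.2.1 (off i.1)))⁻¹ : 𝔸ˣ) : 𝔸)) *
                ((tstairU (emlIterU k U₀) (dbarCovIterU k U₀ U') y i : 𝔸ˣ) : 𝔸)) := by
          funext i
          simp only [Pi.smul_apply, smul_mul_assoc, mul_smul_comm, ← smul_sub]
        rw [hin, map_smul]
        simp only [smul_mul_assoc, mul_smul_comm, ← smul_add]
    refine ⟨hlin.mk' F, fun N y => ?_⟩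
    rw [IsLinearMap.mk'_apply]
    exact hasDerivAt_frameAccU_succ_at U₀ U' (expUnit_family_zero N) (hasDerivAt_expUnit_family N) k (hV N) y (hτ k y hjk)

end Generic

/-! ## §2 The T³ member -/

section T3

open scoped Matrix.Norms.L2Operator
open T3ContinuumYM3Torus
open T3PrintedRegularMinimiser (RegPr)
open T3SectALandauChart (eta eta_pos bgUnits)

variable (F : T3Family) {n K : ℕ}

/-- ★★★ **ROW-V AT THE T³ MEMBER**: for `U₀ ∈ 𝔘_k(ε₀)` (`10¹²L³ε₀ ≤ 1`), `U′ = e^{A₁}U₀ ∈ 𝔘_k(ε₀′)` (`10⁷L³ε₀′ ≤ 1`), `‖A₁‖ < e·η` (`10⁹L²e ≤ 1`), there is a ℂ-linear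
`V : (Site (F.P K) 0 → M₂) →ₗ[ℂ] (Site (F.P K) (K − n) → M₂)` with `d∕dt|₀ frameAccU (K−n) U₀♭ ((U′♭)^{exp(tN)}) x = V N x` for every `N`, `x` — the `V` letter of the (P2)-KNIT-Y1
(★w5-20520 g7's shape verbatim); `‖τ_j − 1‖ < 1∕3` is ✓`towerData_of_regPr`'s first row (`≤ 60L·c·(Lʲη) ≤ 10⁻⁶`). [cite: Balaban1985Averaging, (97) p.32; Balaban1985BackgroundPropagators, (3.19) p.393; Balaban1985Variational, (2) p.278, (44) p.285] -/
theorem exists_linear_frameResponse_of_regPr {ε₀ ε₀' e : ℝ} (hε₀ : 0 < ε₀) (he : 0 < e) (hWe : 10 ^ 9 * (F.L : ℝ) ^ 2 * e ≤ 1) (hWε : 10 ^ 12 * (F.L : ℝ) ^ 3 * ε₀ ≤ 1)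
    (hε₀' : 0 < ε₀') (hε' : 10 ^ 7 * (F.L : ℝ) ^ 3 * ε₀' ≤ 1)
    (U₀ U' : GaugeField (F.P K) 0 (Matrix.specialUnitaryGroup (Fin 2) ℂ)) (hreg : RegPr F n K ε₀ U₀) (hreg' : RegPr F n K ε₀' U')
    (A₁ : PBond (F.P K) 0 → Matrix (Fin 2) (Fin 2) ℂ) (hA₁ : ‖A₁‖ < e * eta F n K)
    (hU' : ∀ b, ((U' b : Matrix.specialUnitaryGroup (Fin 2) ℂ) : Matrix (Fin 2) (Fin 2) ℂ) = exp (A₁ b) * ((U₀ b : Matrix.specialUnitaryGroup (Fin 2) ℂ) : Matrix (Fin 2) (Fin 2) ℂ)) :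
    ∃ V : (Site (F.P K) 0 → Matrix (Fin 2) (Fin 2) ℂ) →ₗ[ℂ] (Site (F.P K) (K - n) → Matrix (Fin 2) (Fin 2) ℂ),
      ∀ (N : Site (F.P K) 0 → Matrix (Fin 2) (Fin 2) ℂ) (x : Site (F.P K) (K - n)),
        HasDerivAt (fun t : ℝ => ((frameAccU (K - n) (bgUnits F K U₀) (gaugeActT (fun z : Site (F.P K) 0 => expUnit (t • N z)) (bgUnits F K U')) x :
          (Matrix (Fin 2) (Fin 2) ℂ)ˣ) : Matrix (Fin 2) (Fin 2) ℂ)) (V N x) 0 := by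
  obtain ⟨hτ, -⟩ := towerData_of_regPr F hε₀ he hWe hWε hε₀' hε' U₀ U' hreg hreg' A₁ hA₁ hU'
  have hL3 : 3 ≤ F.L := by obtain ⟨a, ha⟩ := F.hL.1; have := F.hL.2; omega
  have hL1 : (1 : ℝ) ≤ F.L := by exact_mod_cast (show 1 ≤ F.L by omega)
  have hτ' : ∀ (j : ℕ) (y : Site (F.P K) (j + 1)), j < K - n →
      ‖(fun i : Idx (F.P K) => ((tstairU (emlIterU j (bgUnits F K U₀)) (dbarCovIterU j (bgUnits F K U₀) (bgUnits F K U')) y i : (Matrix (Fin 2) (Fin 2) ℂ)ˣ) :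
        Matrix (Fin 2) (Fin 2) ℂ)) - 1‖ < 1 / 3 := by
    intro j y hj
    refine (hτ j y hj).trans_lt ?_
    have hX : (F.L : ℝ) ^ j * eta F n K ≤ 1 := Prop7SymAvgTwSym.pow_mul_eta_le_one F hj.le
    have hu : (F.L : ℝ) ^ 2 * e ≤ 1 / 10 ^ 9 := by rw [le_div_iff₀ (by positivity)]; linarith
    have hv : (F.L : ℝ) ^ 3 * ε₀ ≤ 1 / 10 ^ 12 := by rw [le_div_iff₀ (by positivity)]; linarith
    have h1 : (F.L : ℝ) * e ≤ (F.L : ℝ) ^ 2 * e := mul_le_mul_of_nonneg_right (le_self_pow₀ hL1 two_ne_zero) he.le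
    have h2 : (F.L : ℝ) ^ 2 * ε₀ ≤ (F.L : ℝ) ^ 3 * ε₀ := mul_le_mul_of_nonneg_right (pow_le_pow_right₀ hL1 (by norm_num)) hε₀.le
    have hη : 0 < eta F n K := eta_pos F n K
    calc 60 * (F.L : ℝ) * ((2 * e + 2700 * (F.L : ℝ) * ε₀) * ((F.L : ℝ) ^ j * eta F n K))
        ≤ 60 * (F.L : ℝ) * ((2 * e + 2700 * (F.L : ℝ) * ε₀) * 1) := by gcongr
      _ = 120 * ((F.L : ℝ) * e) + 162000 * ((F.L : ℝ) ^ 2 * ε₀) := by ring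
      _ < 1 / 3 := by linarith
  exact exists_linear_frameResponse (bgUnits F K U₀) (bgUnits F K U') (K - n) hτ' (K - n) le_rfl

end T3

end Summit.QuantumFields.YangMills.Theorems.Prop7FrameCorrectedMinusMean

end
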